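import Summits.QuantumFields.YangMills.Theorems.BalabanUVNodesN09OneDefectAveraging
import HarnessLib

/-!
# S2β · DET-REP (B) — (β3): A ONE-BOND MOVE INSIDE THE SMALL-PLAQUETTE WINDOW IS AUTOMATICALLY SMALL
# (`U`, `X` plaquette-small and equal off one bond `c` ⟹ `dist1(U(c)·X(c)⁻¹) < θ_U + θ_X`)

Cell `ym3-torus` (rung R3: continuum `SU(2)` Yang–Mills on `T³` — NOT `d = 4`, NOT infinite volume, NOT a mass gap, NOT Clay); seat
`ymfull-r3-prover-4` g0 (R590-ym (a) item (4), DET-REP (B)); definition-free helper of the crux `stmt-QuantumFields-20520`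
(`--supports … --as helper`, NOT a proof of it and NOT a proof of any registered stub).  Piece (β3) of HOME
`ymfull-r3-prover-4/g0/LOCATE-BETA-INTERBLOCK-r3p4g0.md` (20520 evidence #54): the corners `U, V, W, Z` of a window quadrilateral of `def DetRepB`
(registry `Cruxes/FluctuationComparisonRegPrIntL/Lines/semiclassical_s2beta.lean` v11.4 :1078–1081) are window data (`PlaqSmall θ`) agreeing off one bond; the
registry never bounds the size of the move at that bond — it need not: any plaquette through the bond reads the move.

* ★★ `dist1_mul_inv_lt_of_agree_off_bond` (the file's one theorem) — generic torus `P`, level `j`, gauge group `G`: `PlaqSmall θU U`, `PlaqSmall θX X`, `U e = X e` for `e ≠ c`, and a second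
  direction `ν ≠ c.dir` (any `d ≥ 2`) ⟹ `dist1 (U c * (X c)⁻¹) < θU + θX`.  Mechanism: for the plaquette `p` spanned by `c` and `ν` at `c.src`, the three other bonds of `∂p`
  are untouched, so `U(∂p)·X(∂p)⁻¹` (or `U(∂p)⁻¹·X(∂p)` when `ν < c.dir`, where `c` is the last, inverted, factor) telescopes to `U(c)·X(c)⁻¹`; then `dist1_mul_le`,
  `dist1_inv`.  Ingredient `x + e_ν ≠ x`: ✓`…BalabanUVNodesN09OneDefectAveraging.shift_ne_self` BY NAME (the gate's `dedup.landed` pointed to it).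
USE ((β) of CLOSE-BOND-MIN, piece (β3)): the descended data of the two corner minimisers differ on ≤ 2 coarse bonds by `< 2·θBal(cw·b₀)(J)` each.

HONEST SCOPE.  One plaquette identity; def-free; default heartbeats; proves nothing of (β) ∕ CLOSE-BOND-MIN ∕ DET-REP (B) ∕ GAP♯ ∕ S2β ∕ the crux 20520; finite-volume∕conditional
programme; `YM3TorusSU2` NOT proved; rung R3 = SU(2) YM₃ on T³ — NOT d = 4, NOT infinite volume, NOT a mass gap, NOT Clay; the Yang–Mills mass gap is NOT proved.

References: [Balaban1985Averaging] CMP 98 (1985) (9) p. 19 (plaquette variables); [Balaban1987RG1] CMP 109 (1987) (0.18) p. 255 (small plaquette variables);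
[Balaban1985RegularSpaces] CMP 99 (1985) Lemma 1 (1.24)–(1.26) pp. 79–80 (where the two-data closeness is used).
-/

namespace Summit.QuantumFields.YangMills.Theorems.FluctuationComparisonRegPrIntLS2BetaOneBondMoveSmall

open Literature.MathematicalPhysics.QuantumFieldTheory.Balaban1983to89
open Summit.QuantumFields.YangMills.BalabanUVNodes.N09OneDefectAveraging (shift_ne_self)

variable {P : Params} {j : ℕ} {G : Type*} [GaugeGroup G]

/-- ★★ **A ONE-BOND MOVE INSIDE THE SMALL-PLAQUETTE WINDOW IS SMALL**: if `U` and `X` have all plaquette variables within `θU`, `θX` of `1` and agree off the bond `c`,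
then `dist1 (U c · (X c)⁻¹) < θU + θX` — read off the plaquette spanned by `c` and any second direction `ν ≠ c.dir`.
[cite: Balaban1985Averaging, (9) p.19; Balaban1987RG1, (0.18) p.255] -/
theorem dist1_mul_inv_lt_of_agree_off_bond {θU θX : ℝ} {U X : GaugeField P j G}
    (hU : PlaqSmall θU U) (hX : PlaqSmall θX X) (c : PBond P j) (ν : Fin P.d) (hν : ν ≠ c.dir)
    (hagree : ∀ e : PBond P j, e ≠ c → U e = X e) :
    dist1 (U c * (X c)⁻¹) < θU + θX := by
  -- the three other bonds of the plaquette through `c` and `ν` are not `c`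
  have hA : (⟨c.src.shift c.dir, ν⟩ : PBond P j) ≠ c := fun h => hν (by rw [← h])
  have hB : (⟨c.src.shift ν, c.dir⟩ : PBond P j) ≠ c := fun h => shift_ne_self c.src ν (by
    have h' := congrArg PBond.src h
    exact h')
  have hC : (⟨c.src, ν⟩ : PBond P j) ≠ c := fun h => hν (by rw [← h])
  have hc : (⟨c.src, c.dir⟩ : PBond P j) = c := rfl
  rcases lt_or_gt_of_ne hν with hlt | hgt
  · -- `ν < c.dir`: the plaquette `⟨c.src, ν, c.dir⟩`; `c` is its last (inverted) factor
    set p : Plaq P j := ⟨c.src, ν, c.dir, hlt⟩ with hp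
    have hPU : GaugeField.plaqHol U p = U ⟨c.src, ν⟩ * U ⟨c.src.shift ν, c.dir⟩ * (U ⟨c.src.shift c.dir, ν⟩)⁻¹ * (U c)⁻¹ := rfl
    have hPX : GaugeField.plaqHol X p = U ⟨c.src, ν⟩ * U ⟨c.src.shift ν, c.dir⟩ * (U ⟨c.src.shift c.dir, ν⟩)⁻¹ * (X c)⁻¹ := by
      show X ⟨c.src, ν⟩ * X ⟨c.src.shift ν, c.dir⟩ * (X ⟨c.src.shift c.dir, ν⟩)⁻¹ * (X ⟨c.src, c.dir⟩)⁻¹ = _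
      rw [← hagree _ hC, ← hagree _ hB, ← hagree _ hA]
    have hkey : U c * (X c)⁻¹ = (GaugeField.plaqHol U p)⁻¹ * GaugeField.plaqHol X p := by
      rw [hPU, hPX]; group
    rw [hkey]
    calc dist1 ((GaugeField.plaqHol U p)⁻¹ * GaugeField.plaqHol X p)
        ≤ dist1 (GaugeField.plaqHol U p)⁻¹ + dist1 (GaugeField.plaqHol X p) := GaugeGroup.dist1_mul_le _ _
      _ = dist1 (GaugeField.plaqHol U p) + dist1 (GaugeField.plaqHol X p) := by rw [GaugeGroup.dist1_inv]
      _ < θU + θX := add_lt_add (hU p) (hX p)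
  · -- `c.dir < ν`: the plaquette `⟨c.src, c.dir, ν⟩`; `c` is its first factor
    set p : Plaq P j := ⟨c.src, c.dir, ν, hgt⟩ with hp
    have hPU : GaugeField.plaqHol U p = U c * U ⟨c.src.shift c.dir, ν⟩ * (U ⟨c.src.shift ν, c.dir⟩)⁻¹ * (U ⟨c.src, ν⟩)⁻¹ := rfl
    have hPX : GaugeField.plaqHol X p = X c * U ⟨c.src.shift c.dir, ν⟩ * (U ⟨c.src.shift ν, c.dir⟩)⁻¹ * (U ⟨c.src, ν⟩)⁻¹ := by
      show X ⟨c.src, c.dir⟩ * X ⟨c.src.shift c.dir, ν⟩ * (X ⟨c.src.shift ν, c.dir⟩)⁻¹ * (X ⟨c.src, ν⟩)⁻¹ = _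
      rw [← hagree _ hA, ← hagree _ hB, ← hagree _ hC]
    have hkey : U c * (X c)⁻¹ = GaugeField.plaqHol U p * (GaugeField.plaqHol X p)⁻¹ := by
      rw [hPU, hPX]; group
    rw [hkey]
    calc dist1 (GaugeField.plaqHol U p * (GaugeField.plaqHol X p)⁻¹)
        ≤ dist1 (GaugeField.plaqHol U p) + dist1 (GaugeField.plaqHol X p)⁻¹ := GaugeGroup.dist1_mul_le _ _
      _ = dist1 (GaugeField.plaqHol U p) + dist1 (GaugeField.plaqHol X p) := by rw [GaugeGroup.dist1_inv]
      _ < θU + θX := add_lt_add (hU p) (hX p)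

end Summit.QuantumFields.YangMills.Theorems.FluctuationComparisonRegPrIntLS2BetaOneBondMoveSmall
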